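import Summits.ABC.ABC.Theorems.CongruentialReceptacleTameLocalReceptacleDefs
import Summits.ABC.ABC.Theorems.TameLocalReceptacle.Negative.TameLocalReceptacleFalseOfPinningHypothesis

/-!
# Crux `TameLocalReceptacle` (stmt-ABC-14354), line `SketchIdeator1` (reshaped, cycle 2):
# first-moment matching ⇒ no single-table receptacle

Registered stub `stub_false_of_matching` of the reshaped checked skeleton
`Cruxes/TameLocalReceptacle/Lines/SketchIdeator1.lean` (lead `prover-line-stmt-ABC-14354-c1-0`):
`MatchingFamilies κ → 0 < κ → ¬ IntegerTameReceptacle`.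

The FIVE-FAMILY first-moment argument (NegativeNotes-ideator1 §4 re-run with residues): for a windowed
table `t` with `|Φ_t| ≤ c₃` on the `κ`-cell, write `Φ_t(T) = t(2; D₂(T)) + c₁'·(A°_w + B°_w + C°_w)(T)` with
`w = t/c₁'` window-bounded and `A°, B°, C°` the position parts away from `2` (`oddPartA/B/C`).  On the special
family `F_A` (`2^N ∥ a`) the `2`-term is the EXACT entry `τ_A(N) = t(2; N,0,0; 1,1,1) ≥ c₁(2N − 7) log 2`
(lower window, `ε = 1`); on the generic families `G, G'` (`v₂(abc) ≤ V₀`) it is `O(c₁'(V₀+1))` (upper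
window).  Matching the nine position means within `δN` (hypothesis MF) and adding the three special
equations against twice `G` and once `G'` gives `Σ_pos τ(N) ≤ 6c₃ + 3c₁'(V₀+1) log 2 + 9 c₁' δ N`, while the
lower window gives `Σ_pos τ(N) ≥ 3c₁(2N − 7) log 2`; with `δ = c₁ log 2 / (3c₁')` this fails for `N` large.
No certificate, no ω-slack, no upper window away from `2`: only qualitative (relative `o(1)`) matching is used.
-/

-- `Summit.<Summit>.<Problem>` is the mandated summit-side namespace (CONVENTIONS §2); for the
-- single-conjunct summit `ABC` the two coincide, so the duplicate `ABC.ABC` is deliberate.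
set_option linter.dupNamespace false

namespace Summit.ABC.ABC.Theorems.TameLocalReceptacle

open Finset Literature.NumberTheory.DiophantineGeometry


/-! ### Splitting the receptacle sum at `2` and by positions -/

/-- A sum over the odd primes of `abc` (pairwise coprime positive triple) splits over the members. -/
theorem sum_primeFactors_erase_two_split (G : ℕ → ℝ) {a b c : ℕ} (h : IsABCTriple a b c) :
    ∑ p ∈ (a * b * c).primeFactors.erase 2, G p
      = ∑ p ∈ a.primeFactors.erase 2, G p + ∑ p ∈ b.primeFactors.erase 2, G p
        + ∑ p ∈ c.primeFactors.erase 2, G p := by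
  obtain ⟨ha, hb, habc, hab⟩ := h
  have hc : 0 < c := by omega
  have hac : Nat.Coprime a c := by rw [← habc]; exact Nat.coprime_self_add_right.mpr hab
  have hbc : Nat.Coprime b c := by rw [← habc]; exact Nat.coprime_add_self_right.mpr hab.symm
  rw [Nat.primeFactors_mul (Nat.mul_pos ha hb).ne' hc.ne', Nat.primeFactors_mul ha.ne' hb.ne',
    Finset.erase_union_distrib, Finset.erase_union_distrib]
  have d1 : Disjoint (a.primeFactors.erase 2) (b.primeFactors.erase 2) :=
    Disjoint.mono (Finset.erase_subset _ _) (Finset.erase_subset _ _) hab.disjoint_primeFactors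
  have d2 : Disjoint (a.primeFactors.erase 2) (c.primeFactors.erase 2) :=
    Disjoint.mono (Finset.erase_subset _ _) (Finset.erase_subset _ _) hac.disjoint_primeFactors
  have d3 : Disjoint (b.primeFactors.erase 2) (c.primeFactors.erase 2) :=
    Disjoint.mono (Finset.erase_subset _ _) (Finset.erase_subset _ _) hbc.disjoint_primeFactors
  rw [Finset.sum_union (Finset.disjoint_union_left.mpr ⟨d2, d3⟩), Finset.sum_union d1]

/-- The receptacle sum as a sum of table evaluations at the data (real cast). -/
theorem recSum_cast_eq_sum_evalAt (t : Table) (a b c : ℕ) :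
    (recSum t a b c : ℝ) = ∑ p ∈ (a * b * c).primeFactors,
      evalAt (fun q i j k r s z => (t q i j k r s z : ℝ)) p (datum a b c p) := by
  unfold recSum
  push_cast
  rfl

/-- **Splitting at `2` and by positions.** For an abc-triple,
`Φ_t = t(2; D₂) + A° + B° + C°` (real cast). -/
theorem recSum_eq_two_add_oddParts (t : Table) {a b c : ℕ} (h : IsABCTriple a b c) :
    (recSum t a b c : ℝ) = evalAt (fun q i j k r s z => (t q i j k r s z : ℝ)) 2 (datum a b c 2)
      + oddPartA (fun q i j k r s z => (t q i j k r s z : ℝ)) a b c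
      + oddPartB (fun q i j k r s z => (t q i j k r s z : ℝ)) a b c
      + oddPartC (fun q i j k r s z => (t q i j k r s z : ℝ)) a b c := by
  -- `2 ∣ abc`: exactly one member of an abc-triple is even (reproved inline; cf.
  -- `AbcValuationProduct.two_mem_primeFactors`, not imported to keep the closure small)
  have h2 : 2 ∈ (a * b * c).primeFactors := by
    obtain ⟨ha, hb, habc, _⟩ := h
    have hc : 0 < c := by omega
    refine Nat.mem_primeFactors.mpr ⟨Nat.prime_two, ?_, by positivity⟩
    rcases Nat.even_or_odd a with hae | hao
    · exact (hae.two_dvd.mul_right b).mul_right c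
    rcases Nat.even_or_odd b with hbe | hbo
    · exact (hbe.two_dvd.mul_left a).mul_right c
    have hce : Even c := by rw [← habc]; exact hao.add_odd hbo
    exact hce.two_dvd.mul_left (a * b)
  rw [recSum_cast_eq_sum_evalAt, ← Finset.add_sum_erase _ _ h2, sum_primeFactors_erase_two_split _ h]
  unfold oddPartA oddPartB oddPartC
  ring

/-- Scaling a weight scales each position part. -/
theorem oddParts_smul (t : Table) {c₁' : ℝ} (hc : c₁' ≠ 0) (a b c : ℕ) :
    oddPartA (fun q i j k r s z => (t q i j k r s z : ℝ)) a b c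
        = c₁' * oddPartA (fun q i j k r s z => (t q i j k r s z : ℝ) / c₁') a b c ∧
      oddPartB (fun q i j k r s z => (t q i j k r s z : ℝ)) a b c
        = c₁' * oddPartB (fun q i j k r s z => (t q i j k r s z : ℝ) / c₁') a b c ∧
      oddPartC (fun q i j k r s z => (t q i j k r s z : ℝ)) a b c
        = c₁' * oddPartC (fun q i j k r s z => (t q i j k r s z : ℝ) / c₁') a b c := by
  unfold oddPartA oddPartB oddPartC evalAt
  refine ⟨?_, ?_, ?_⟩ <;>
  · rw [Finset.mul_sum]
    refine Finset.sum_congr rfl fun q _ => ?_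
    field_simp

/-! ### The datum at `2` on the special families -/

/-- Odd numbers have residue `1` mod `2`. -/
private theorem mod_two_of_not_dvd {n : ℕ} (h : ¬ 2 ∣ n) : n % 2 = 1 := Nat.two_dvd_ne_zero.mp h

/-- If `2^N ∥ a` with `N ≥ 1` in an abc-triple then `D₂ = (N,0,0; 1,1,1)`. -/
theorem datum_two_of_posA {a b c N : ℕ} (h : IsABCTriple a b c) (hN : a.factorization 2 = N)
    (h1 : 1 ≤ N) : datum a b c 2 = (N, 0, 0, 1, 1, 1) := by
  obtain ⟨ha, _, habc, hab⟩ := h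
  have h2a : 2 ∣ a := Nat.dvd_of_factorization_pos (by omega)
  have h2b : ¬ 2 ∣ b := fun h2b => by
    have hg := Nat.dvd_gcd h2a h2b
    rw [hab.gcd_eq_one] at hg
    omega
  have h2c : ¬ 2 ∣ c := by rw [← habc]; exact fun h => h2b ((Nat.dvd_add_right h2a).mp h)
  have hra : a / 2 ^ N % 2 = 1 := by
    rw [← hN]; exact mod_two_of_not_dvd (Nat.not_dvd_ordCompl Nat.prime_two ha.ne')
  simp only [datum, hN, Nat.factorization_eq_zero_of_not_dvd h2b, Nat.factorization_eq_zero_of_not_dvd h2c,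
    pow_zero, Nat.div_one, hra, mod_two_of_not_dvd h2b, mod_two_of_not_dvd h2c]

/-- If `2^N ∥ b` with `N ≥ 1` in an abc-triple then `D₂ = (0,N,0; 1,1,1)`. -/
theorem datum_two_of_posB {a b c N : ℕ} (h : IsABCTriple a b c) (hN : b.factorization 2 = N)
    (h1 : 1 ≤ N) : datum a b c 2 = (0, N, 0, 1, 1, 1) := by
  obtain ⟨_, hb, habc, hab⟩ := h
  have h2b : 2 ∣ b := Nat.dvd_of_factorization_pos (by omega)
  have h2a : ¬ 2 ∣ a := fun h2a => by
    have hg := Nat.dvd_gcd h2a h2b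
    rw [hab.gcd_eq_one] at hg
    omega
  have h2c : ¬ 2 ∣ c := by rw [← habc]; exact fun h => h2a ((Nat.dvd_add_left h2b).mp h)
  have hrb : b / 2 ^ N % 2 = 1 := by
    rw [← hN]; exact mod_two_of_not_dvd (Nat.not_dvd_ordCompl Nat.prime_two hb.ne')
  simp only [datum, hN, Nat.factorization_eq_zero_of_not_dvd h2a, Nat.factorization_eq_zero_of_not_dvd h2c,
    pow_zero, Nat.div_one, hrb, mod_two_of_not_dvd h2a, mod_two_of_not_dvd h2c]

/-- If `2^N ∥ c` with `N ≥ 1` in an abc-triple then `D₂ = (0,0,N; 1,1,1)`. -/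
theorem datum_two_of_posC {a b c N : ℕ} (h : IsABCTriple a b c) (hN : c.factorization 2 = N)
    (h1 : 1 ≤ N) : datum a b c 2 = (0, 0, N, 1, 1, 1) := by
  obtain ⟨_, _, habc, hab⟩ := h
  have hc : c ≠ 0 := by omega
  have h2c : 2 ∣ c := Nat.dvd_of_factorization_pos (by omega)
  have h2ab : 2 ∣ a + b := habc ▸ h2c
  have h2a : ¬ 2 ∣ a := fun h2a => by
    have h2b : 2 ∣ b := (Nat.dvd_add_right h2a).mp h2ab
    have hg := Nat.dvd_gcd h2a h2b
    rw [hab.gcd_eq_one] at hg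
    omega
  have h2b : ¬ 2 ∣ b := fun h2b => h2a ((Nat.dvd_add_left h2b).mp h2ab)
  have hrc : c / 2 ^ N % 2 = 1 := by
    rw [← hN]; exact mod_two_of_not_dvd (Nat.not_dvd_ordCompl Nat.prime_two hc)
  simp only [datum, hN, Nat.factorization_eq_zero_of_not_dvd h2a, Nat.factorization_eq_zero_of_not_dvd h2b,
    pow_zero, Nat.div_one, hrc, mod_two_of_not_dvd h2a, mod_two_of_not_dvd h2b]

/-- On a generic family member (`v₂(abc) ≤ V₀`) the `2`-term is within the upper window
`c₁'(V₀+1) log 2`. -/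
theorem abs_evalAt_two_le {ε c₁ c₁' : ℝ} {t : Table} (hw : InWindow ε c₁ c₁' t) (hc₁' : 0 ≤ c₁')
    {a b c V₀ : ℕ} (h : IsABCTriple a b c) (hV : (a * b * c).factorization 2 ≤ V₀) :
    |evalAt (fun q i j k r s z => (t q i j k r s z : ℝ)) 2 (datum a b c 2)|
      ≤ c₁' * ((V₀ : ℝ) + 1) * Real.log 2 := by
  obtain ⟨ha, hb, habc, _⟩ := h
  have hc : c ≠ 0 := by omega
  have hsum : a.factorization 2 + b.factorization 2 + c.factorization 2 ≤ V₀ := by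
    have e : (a * b * c).factorization 2 = a.factorization 2 + b.factorization 2 + c.factorization 2 := by
      rw [Nat.factorization_mul (Nat.mul_ne_zero ha.ne' hb.ne') hc, Nat.factorization_mul ha.ne' hb.ne']
      rfl
    omega
  have hup := (hw 2 (a.factorization 2) (b.factorization 2) (c.factorization 2)
    (a / 2 ^ a.factorization 2 % 2) (b / 2 ^ b.factorization 2 % 2) (c / 2 ^ c.factorization 2 % 2)
    Nat.prime_two).2
  have hcast : ((a.factorization 2 + b.factorization 2 + c.factorization 2 : ℕ) : ℝ) ≤ (V₀ : ℝ) := by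
    exact_mod_cast hsum
  have hlog : 0 ≤ Real.log ((2 : ℕ) : ℝ) := Real.log_natCast_nonneg 2
  calc |evalAt (fun q i j k r s z => (t q i j k r s z : ℝ)) 2 (datum a b c 2)|
      = |(t 2 (a.factorization 2) (b.factorization 2) (c.factorization 2) (a / 2 ^ a.factorization 2 % 2)
          (b / 2 ^ b.factorization 2 % 2) (c / 2 ^ c.factorization 2 % 2) : ℝ)| := rfl
    _ ≤ c₁' * (((a.factorization 2 + b.factorization 2 + c.factorization 2 : ℕ) : ℝ) + 1)
          * Real.log ((2 : ℕ) : ℝ) := hup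
    _ ≤ c₁' * ((V₀ : ℝ) + 1) * Real.log ((2 : ℕ) : ℝ) := by
        apply mul_le_mul_of_nonneg_right _ hlog
        exact mul_le_mul_of_nonneg_left (by linarith) hc₁'
    _ = c₁' * ((V₀ : ℝ) + 1) * Real.log 2 := by norm_num

/-! ### Means -/

/-- Means are linear: constant plus a multiple of a three-term sum. -/
theorem mean_const_add_mul_sum3 {F : Finset (ℕ × ℕ × ℕ)} (hF : F.Nonempty) (C m : ℝ)
    (f g h : ℕ × ℕ × ℕ → ℝ) :
    mean F (fun T => C + m * (f T + g T + h T)) = C + m * (mean F f + mean F g + mean F h) := by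
  have hc : (F.card : ℝ) ≠ 0 := by exact_mod_cast hF.card_pos.ne'
  simp only [mean]
  rw [Finset.sum_add_distrib, Finset.sum_const, nsmul_eq_mul, ← Finset.mul_sum,
    Finset.sum_add_distrib, Finset.sum_add_distrib]
  field_simp

/-- Means are linear: a function plus a multiple of a three-term sum. -/
theorem mean_add_mul_sum3 (F : Finset (ℕ × ℕ × ℕ)) (m : ℝ) (f₀ f g h : ℕ × ℕ × ℕ → ℝ) :
    mean F (fun T => f₀ T + m * (f T + g T + h T)) = mean F f₀ + m * (mean F f + mean F g + mean F h) := by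
  simp only [mean]
  rw [Finset.sum_add_distrib, ← Finset.mul_sum, Finset.sum_add_distrib, Finset.sum_add_distrib]
  ring

/-- Means agree when the functions agree on the family. -/
theorem mean_congr {F : Finset (ℕ × ℕ × ℕ)} {f g : ℕ × ℕ × ℕ → ℝ} (h : ∀ T ∈ F, f T = g T) :
    mean F f = mean F g := by
  simp only [mean]
  rw [Finset.sum_congr rfl h]

/-- A pointwise absolute bound passes to the mean. -/
theorem abs_mean_le {F : Finset (ℕ × ℕ × ℕ)} (hF : F.Nonempty) {f : ℕ × ℕ × ℕ → ℝ} {C : ℝ}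
    (h : ∀ T ∈ F, |f T| ≤ C) : |mean F f| ≤ C := by
  have hc : (0 : ℝ) < F.card := by exact_mod_cast hF.card_pos
  simp only [mean]
  rw [abs_div, abs_of_pos hc, div_le_iff₀ hc]
  calc |∑ x ∈ F, f x| ≤ ∑ x ∈ F, |f x| := abs_sum_le_sum_abs _ _
    _ ≤ ∑ _x ∈ F, C := sum_le_sum h
    _ = C * F.card := by rw [sum_const, nsmul_eq_mul, mul_comm]

/-! ### The endgame (pure real arithmetic of the five family equations) -/

/-- The linear bookkeeping: three special equations, two generic ones, nine matchings, three lower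
windows and the threshold are contradictory. -/
theorem fiveFamilies_endgame
    {c₁ c₁' c₃ L δ V N τA τB τC aA bA cA aB bB cB aC bC cC α β γ α' β' γ' μ μ' : ℝ}
    (hc₁' : 0 < c₁') (hδc : c₁' * δ = c₁ * L / 3)
    (hKN : 6 * c₃ + 3 * (c₁' * (V + 1) * L) + 21 * (c₁ * L) < 3 * (c₁ * L * N))
    (hτA : 2 * (c₁ * L * N) - 7 * (c₁ * L) ≤ τA) (hτB : 2 * (c₁ * L * N) - 7 * (c₁ * L) ≤ τB)
    (hτC : 2 * (c₁ * L * N) - 7 * (c₁ * L) ≤ τC)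
    (eA : |τA + c₁' * (aA + bA + cA)| ≤ c₃) (eB : |τB + c₁' * (aB + bB + cB)| ≤ c₃)
    (eC : |τC + c₁' * (aC + bC + cC)| ≤ c₃)
    (eG : |μ + c₁' * (α + β + γ)| ≤ c₃) (eG' : |μ' + c₁' * (α' + β' + γ')| ≤ c₃)
    (hμ : |μ| ≤ c₁' * (V + 1) * L) (hμ' : |μ'| ≤ c₁' * (V + 1) * L)
    (m1 : |aA - α'| ≤ δ * N) (m2 : |bA - β| ≤ δ * N) (m3 : |cA - γ| ≤ δ * N)
    (m4 : |aB - α| ≤ δ * N) (m5 : |bB - β'| ≤ δ * N) (m6 : |cB - γ| ≤ δ * N)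
    (m7 : |aC - α| ≤ δ * N) (m8 : |bC - β| ≤ δ * N) (m9 : |cC - γ'| ≤ δ * N) : False := by
  have hδN : c₁' * (δ * N) = (c₁ * L * N) / 3 := by rw [← mul_assoc, hδc]; ring
  -- matchings times `c₁'`
  have key : ∀ {x y : ℝ}, |x - y| ≤ δ * N → c₁' * y - c₁' * x ≤ (c₁ * L * N) / 3 := by
    intro x y hxy
    have h := mul_le_mul_of_nonneg_left (show y - x ≤ δ * N by linarith [(abs_le.mp hxy).1]) hc₁'.le
    rw [mul_sub, hδN] at h; exact h
  have k1 := key m1; have k2 := key m2; have k3 := key m3; have k4 := key m4; have k5 := key m5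
  have k6 := key m6; have k7 := key m7; have k8 := key m8; have k9 := key m9
  -- the five equations, expanded
  have eA' := (abs_le.mp eA).2
  have eB' := (abs_le.mp eB).2
  have eC' := (abs_le.mp eC).2
  have eG1 := (abs_le.mp eG).1
  have eG'1 := (abs_le.mp eG').1
  have hμ1 := (abs_le.mp hμ).2
  have hμ'1 := (abs_le.mp hμ').2
  rw [mul_add, mul_add] at eA' eB' eC' eG1 eG'1
  linarith

/-! ### The stub -/

/-- **FIRST-MOMENT MATCHING ⇒ NO SINGLE-TABLE RECEPTACLE** (registered stub `stub_false_of_matching` of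
the reshaped checked skeleton of stmt-ABC-14354, line `SketchIdeator1`).  Under the qualitative matching
hypothesis `MatchingFamilies κ` (`0 < κ`), no windowed integer table has receptacle sums bounded on the
`κ`-cell: the five-family first-moment argument of the module docstring (exact `2`-adic entries of the
three special families against the position means of two generic families at the two scales; only the
lower window at `2`, the upper window at `2` on the generic families, and `ε = 1` are used). [folklore] -/
theorem stub_false_of_matching :
    ∀ κ : ℝ, MatchingFamilies κ → 0 < κ → ¬ IntegerTameReceptacle := by
  intro κ hM hκ hI
  obtain ⟨c₁, c₁', c₃, hc₁, t, hw, hB⟩ := hI κ hκ 1 one_pos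
  have hc₁' : 0 < c₁' := c₁'_pos_of_inWindow le_rfl hc₁ hw
  obtain ⟨V₀, hV⟩ := hM
  set L : ℝ := Real.log 2 with hL
  have hL0 : 0 < L := Real.log_pos (by norm_num)
  set δ : ℝ := c₁ * L / (3 * c₁') with hδ
  have hδ0 : 0 < δ := by positivity
  have hδc : c₁' * δ = c₁ * L / 3 := by rw [hδ]; field_simp
  set K : ℝ := 6 * c₃ + 3 * (c₁' * ((V₀ : ℝ) + 1) * L) + 21 * (c₁ * L) with hK
  set N₁ : ℕ := ⌈K / (3 * (c₁ * L))⌉₊ + 1 with hN₁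
  obtain ⟨N, hN₁N, FA, FB, FC, G, G', hFAne, hFBne, hFCne, hGne, hG'ne, hFA, hFB, hFC, hG, hG',
    hmatch⟩ := hV δ hδ0 N₁
  have hN1 : 1 ≤ N := le_trans (Nat.le_add_left 1 _) hN₁N
  have hKN : K < 3 * (c₁ * L * N) := by
    have h1 : K / (3 * (c₁ * L)) < N := by
      calc K / (3 * (c₁ * L)) ≤ ⌈K / (3 * (c₁ * L))⌉₊ := Nat.le_ceil _
        _ < (N₁ : ℝ) := by rw [hN₁]; push_cast; linarith
        _ ≤ N := by exact_mod_cast hN₁N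
    have h2 := (div_lt_iff₀ (by positivity)).mp h1
    linarith [h2]
  -- the window-bounded weight `w = t / c₁'`
  set w : RTable := fun q i j k r s z => (t q i j k r s z : ℝ) / c₁' with hw_def
  have hwb : WindowBounded w := by
    intro q i' j' k' r₀ s₀ z₀ hq
    simp only [hw_def]
    rw [abs_div, abs_of_pos hc₁', div_le_iff₀ hc₁']
    calc |(t q i' j' k' r₀ s₀ z₀ : ℝ)| ≤ c₁' * (((i' + j' + k' : ℕ) : ℝ) + 1) * Real.log q :=
        (hw q i' j' k' r₀ s₀ z₀ hq).2
      _ = (((i' + j' + k' : ℕ) : ℝ) + 1) * Real.log q * c₁' := by ring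
  obtain ⟨m1, m2, m3, m4, m5, m6, m7, m8, m9⟩ := hmatch w hwb
  -- the three position parts as functions of a triple
  set fA : ℕ × ℕ × ℕ → ℝ := fun T => oddPartA w T.1 T.2.1 T.2.2 with hfA
  set fB : ℕ × ℕ × ℕ → ℝ := fun T => oddPartB w T.1 T.2.1 T.2.2 with hfB
  set fC : ℕ × ℕ × ℕ → ℝ := fun T => oddPartC w T.1 T.2.1 T.2.2 with hfC
  set Φ : ℕ × ℕ × ℕ → ℝ := fun T => (recSum t T.1 T.2.1 T.2.2 : ℝ) with hΦ
  set P₂ : ℕ × ℕ × ℕ → ℝ := fun T =>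
    evalAt (fun q i j k r s z => (t q i j k r s z : ℝ)) 2 (datum T.1 T.2.1 T.2.2 2) with hP₂
  -- pointwise decomposition on any abc-triple
  have hdec : ∀ T : ℕ × ℕ × ℕ, IsABCTriple T.1 T.2.1 T.2.2 →
      Φ T = P₂ T + c₁' * (fA T + fB T + fC T) := by
    intro T hT
    obtain ⟨e1, e2, e3⟩ := oddParts_smul t hc₁'.ne' T.1 T.2.1 T.2.2
    simp only [hΦ, hP₂, hfA, hfB, hfC]
    rw [recSum_eq_two_add_oddParts t hT, e1, e2, e3]
    ring
  -- the lower window at the three special `2`-data (ε = 1)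
  have hlow : ∀ i j k : ℕ, c₁ * (2 * ((i + j + k : ℕ) : ℝ) - 6 - 1) * L ≤ (t 2 i j k 1 1 1 : ℝ) := by
    intro i j k
    have h := (hw 2 i j k 1 1 1 Nat.prime_two).1
    have e : Real.log ((2 : ℕ) : ℝ) = L := by norm_num [hL]
    rw [e] at h
    exact h
  have hτA : 2 * (c₁ * L * N) - 7 * (c₁ * L) ≤ (t 2 N 0 0 1 1 1 : ℝ) := by
    have h := hlow N 0 0
    have e : c₁ * (2 * ((N + 0 + 0 : ℕ) : ℝ) - 6 - 1) * L = 2 * (c₁ * L * N) - 7 * (c₁ * L) := by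
      push_cast; ring
    linarith
  have hτB : 2 * (c₁ * L * N) - 7 * (c₁ * L) ≤ (t 2 0 N 0 1 1 1 : ℝ) := by
    have h := hlow 0 N 0
    have e : c₁ * (2 * ((0 + N + 0 : ℕ) : ℝ) - 6 - 1) * L = 2 * (c₁ * L * N) - 7 * (c₁ * L) := by
      push_cast; ring
    linarith
  have hτC : 2 * (c₁ * L * N) - 7 * (c₁ * L) ≤ (t 2 0 0 N 1 1 1 : ℝ) := by
    have h := hlow 0 0 N
    have e : c₁ * (2 * ((0 + 0 + N : ℕ) : ℝ) - 6 - 1) * L = 2 * (c₁ * L * N) - 7 * (c₁ * L) := by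
      push_cast; ring
    linarith
  -- special family A
  have eA : |(t 2 N 0 0 1 1 1 : ℝ) + c₁' * (mean FA fA + mean FA fB + mean FA fC)| ≤ c₃ := by
    have hpt : ∀ T ∈ FA, Φ T = (t 2 N 0 0 1 1 1 : ℝ) + c₁' * (fA T + fB T + fC T) := by
      intro T hT
      obtain ⟨hbal, hfac⟩ := hFA T hT
      rw [hdec T hbal.1]
      simp only [hP₂]
      rw [datum_two_of_posA hbal.1 hfac hN1]
      rfl
    rw [← mean_const_add_mul_sum3 hFAne, ← mean_congr hpt]
    exact abs_mean_le hFAne fun T hT => hB _ _ _ (hFA T hT).1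
  -- special family B
  have eB : |(t 2 0 N 0 1 1 1 : ℝ) + c₁' * (mean FB fA + mean FB fB + mean FB fC)| ≤ c₃ := by
    have hpt : ∀ T ∈ FB, Φ T = (t 2 0 N 0 1 1 1 : ℝ) + c₁' * (fA T + fB T + fC T) := by
      intro T hT
      obtain ⟨hbal, hfac⟩ := hFB T hT
      rw [hdec T hbal.1]
      simp only [hP₂]
      rw [datum_two_of_posB hbal.1 hfac hN1]
      rfl
    rw [← mean_const_add_mul_sum3 hFBne, ← mean_congr hpt]
    exact abs_mean_le hFBne fun T hT => hB _ _ _ (hFB T hT).1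
  -- special family C
  have eC : |(t 2 0 0 N 1 1 1 : ℝ) + c₁' * (mean FC fA + mean FC fB + mean FC fC)| ≤ c₃ := by
    have hpt : ∀ T ∈ FC, Φ T = (t 2 0 0 N 1 1 1 : ℝ) + c₁' * (fA T + fB T + fC T) := by
      intro T hT
      obtain ⟨hbal, hfac⟩ := hFC T hT
      rw [hdec T hbal.1]
      simp only [hP₂]
      rw [datum_two_of_posC hbal.1 hfac hN1]
      rfl
    rw [← mean_const_add_mul_sum3 hFCne, ← mean_congr hpt]
    exact abs_mean_le hFCne fun T hT => hB _ _ _ (hFC T hT).1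
  -- generic families
  have eG : |mean G P₂ + c₁' * (mean G fA + mean G fB + mean G fC)| ≤ c₃ := by
    have hpt : ∀ T ∈ G, Φ T = P₂ T + c₁' * (fA T + fB T + fC T) := fun T hT => hdec T (hG T hT).1.1
    rw [← mean_add_mul_sum3, ← mean_congr hpt]
    exact abs_mean_le hGne fun T hT => hB _ _ _ (hG T hT).1
  have eG' : |mean G' P₂ + c₁' * (mean G' fA + mean G' fB + mean G' fC)| ≤ c₃ := by
    have hpt : ∀ T ∈ G', Φ T = P₂ T + c₁' * (fA T + fB T + fC T) := fun T hT => hdec T (hG' T hT).1.1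
    rw [← mean_add_mul_sum3, ← mean_congr hpt]
    exact abs_mean_le hG'ne fun T hT => hB _ _ _ (hG' T hT).1
  have hμ : |mean G P₂| ≤ c₁' * ((V₀ : ℝ) + 1) * L :=
    abs_mean_le hGne fun T hT => abs_evalAt_two_le hw hc₁'.le (hG T hT).1.1 (hG T hT).2
  have hμ' : |mean G' P₂| ≤ c₁' * ((V₀ : ℝ) + 1) * L :=
    abs_mean_le hG'ne fun T hT => abs_evalAt_two_le hw hc₁'.le (hG' T hT).1.1 (hG' T hT).2
  exact fiveFamilies_endgame hc₁' hδc hKN hτA hτB hτC eA eB eC eG eG' hμ hμ' m1 m2 m3 m4 m5 m6 m7 m8 m9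

end Summit.ABC.ABC.Theorems.TameLocalReceptacle
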